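import Summits.ABC.ABC.Theorems.PrimePowerRadical.Negative.WieferichSparse
import Summits.ABC.ABC.Theorems.PrimePowerRadical.Negative.Orders

/-!
# The adaptive-design cash-out of a weighted tower inequality (`stub_cashout`)

Stub `stub_cashout` of the line `nevbir-below-beta` for the crux
`Summit.ABC.ABC.Theses.IneffectiveSubspace.PrimePowerRadical` (stmt-ABC-1648), with the line's
skeleton-local definitions `towerG`, `TowerIneq`, `OnCurveBounded` unfolded.

Statement (`stub_cashout`). Let `q ≥ 2`, `n ≥ 3`, weights `c_i ≥ c_min` (`i < n`), `b_Y, ε ≥ 0`,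
`κ := (1+ε)·c_min − b_Y·(n+1)/(2n) > 0` and `θ₀ := 1 + ε − 2b_H − b_Y ≥ 0`. Suppose that off the
plane curve `F = 0` the weighted proximity inequality
`b_H·2h + b_Y·(h − log u) ≤ (1+ε)·(h − G_n(c; q^k − 1, u)) + C` holds for all `k ≥ 1`, `u ∣ q^k − 1`
(`h = k log q`, `G_n(c; m, u) = Σ_{p ∣ m} (Σ_{i<n} c_i · min(v_p(m) − i·v_p(u), v_p(u))⁺) · log p`), and
that the points `(q^k, u)` with `u² ∣ q^k − 1` ON the curve have bounded `u`. Then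
`q^k − 1 ≤ C · q^{(θ₀/κ)·k} · rad(q^k − 1)` for all `k ≥ 1`.

Proof (elementary). Fix `k`, put `m := q^k − 1`, `v_p := v_p(m)`, `D := {p ∣ m : v_p ≥ 2}`,
`j_p := ⌈v_p/n⌉ = (v_p − 1)/n + 1`, and evaluate the inequality at the ADAPTIVE auxiliary point
`u := ∏_{p ∈ D} p^{j_p}`. Arithmetic of `j_p` (`v_p ≥ 2`, `n ≥ 3`): `v_p ≤ n·j_p`
(`cashout_le_mul_ceil`), `2·j_p ≤ v_p` (`cashout_two_mul_ceil_le`, so `u² ∣ m`,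
`cashout_sq_dvd`) and `2n·j_p ≤ (n+1)·v_p` (`cashout_cost_le`). With `V := Σ_{p∈D} v_p log p`:
* FULL CAPTURE `Σ_{i<n} min(v − i·j, j)⁺ = min(v, n·j)` (`cashout_sum_min`), hence
  `G_n(c; m, u) ≥ c_min·V` (`cashout_towerG_ge`; the primes `p ∉ D` contribute `0`);
* COST `log u = Σ_{p∈D} j_p log p ≤ (n+1)/(2n)·V` (`cashout_log_aux_le`) and `V ≤ n·log u`
  (`cashout_sum_le_log_aux`);
* EXCESS `log m − log rad m = Σ_{p ∣ m} (v_p − 1) log p ≤ V`, i.e. `m ≤ rad(m)·e^V`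
  (`cashout_self_le_radical_mul_exp`).
These are packaged in `cashout_aux`. Off the curve the inequality at `(k, u)` rearranges to
`κ·V ≤ θ₀·k log q + C₁`, so `m ≤ rad(m)·e^{C₁/κ}·q^{(θ₀/κ)k}`; on the curve `u ≤ C₂`, so
`V ≤ n·log(max 1 C₂)` is bounded and `q^{(θ₀/κ)k} ≥ 1`. Take `C := max(e^{C₁/κ}, e^{n log max(1,C₂)})`.

Sources: the line file `Cruxes/PrimePowerRadical/Lines/nevbir_below_beta.lean` (docstring of
`stub_cashout`; the real-analysis glue follows its `sqDivisorBound_of_level2`); Mathlib's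
`Nat.factorization` / `Real.log` API; the landed `Negative.factorization_prod_prime_pow`,
`Negative.two_le_pow`. Deliberately NOT here: any claim that such an inequality holds (that is the
neighbouring stubs' business) — this file only cashes one out.
-/

noncomputable section

-- `Summit.<Summit>.<Problem>` is the mandated summit-side namespace (CONVENTIONS §2); for the
-- single-conjunct summit `ABC` the two coincide, so the duplicate `ABC.ABC` is deliberate.
set_option linter.dupNamespace false

namespace Summit.ABC.ABC.Theorems.PrimePowerRadical.NevbirBelowBeta

open Literature.NumberTheory.DiophantineGeometry UniqueFactorizationMonoid
open Summit.ABC.ABC.Theses.IneffectiveSubspace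
open Summit.ABC.ABC.Theorems.PrimePowerRadical.Negative
open scoped BigOperators

/-! ## Arithmetic of the adaptive exponent `j = ⌈v/n⌉ = (v − 1)/n + 1` -/

/-- FULL CAPTURE: `Σ_{i<n} min(v − i·j, j) = min(v, n·j)` (truncated subtraction in `ℕ`). -/
theorem cashout_sum_min (v j n : ℕ) :
    ∑ i ∈ Finset.range n, min (v - i * j) j = min v (n * j) := by
  induction n with
  | zero => simp
  | succ n ih =>
    rw [Finset.sum_range_succ, ih, Nat.succ_mul]
    omega

/-- The ceiling property of `j = (v − 1)/n + 1`: `v ≤ n·j`. -/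
theorem cashout_le_mul_ceil (v : ℕ) {n : ℕ} (hn : 0 < n) : v ≤ n * ((v - 1) / n + 1) := by
  have := Nat.lt_mul_div_succ (v - 1) hn
  omega

/-- For `n ≥ 3` and `v ≥ 2`: `2·((v − 1)/n + 1) ≤ v` (this makes `u² ∣ m`). -/
theorem cashout_two_mul_ceil_le {v n : ℕ} (hn : 3 ≤ n) (hv : 2 ≤ v) :
    2 * ((v - 1) / n + 1) ≤ v := by
  have h2 : (v - 1) / n ≤ (v - 1) / 3 := Nat.div_le_div_left hn (by norm_num)
  omega

/-- For `n ≥ 1` and `v ≥ 2`: `2n·((v − 1)/n + 1) ≤ (n + 1)·v` (the cost of the auxiliary point: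
`⌈v/n⌉ ≤ (n+1)v/(2n)`). -/
theorem cashout_cost_le {v n : ℕ} (hn : 1 ≤ n) (hv : 2 ≤ v) :
    2 * n * ((v - 1) / n + 1) ≤ (n + 1) * v := by
  have h1 : (v - 1) / n * n ≤ v - 1 := Nat.div_mul_le_self (v - 1) n
  have h2 : (v - 1) / n * n + 1 ≤ v := by omega
  nlinarith [h2, hn, hv]

/-! ## The auxiliary point `∏_{p ∈ D} p^{e p}` over a finite set `D` of primes -/

/-- A finite product of prime powers is positive. -/
theorem cashout_prod_pow_pos {D : Finset ℕ} (hDP : ∀ r ∈ D, r.Prime) (e : ℕ → ℕ) :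
    0 < ∏ r ∈ D, r ^ e r :=
  Finset.prod_pos fun r hr => pow_pos (hDP r hr).pos _

/-- `log ∏_{p∈D} p^{e p} = Σ_{p∈D} e p · log p`. -/
theorem cashout_log_prod_pow {D : Finset ℕ} (hDP : ∀ r ∈ D, r.Prime) (e : ℕ → ℕ) :
    Real.log ((∏ r ∈ D, r ^ e r : ℕ) : ℝ) = ∑ r ∈ D, (e r : ℝ) * Real.log r := by
  rw [Nat.cast_prod, Real.log_prod]
  · exact Finset.sum_congr rfl fun r _ => by rw [Nat.cast_pow, Real.log_pow]
  · intro r hr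
    exact_mod_cast pow_ne_zero _ (hDP r hr).ne_zero

/-- If `2·e p ≤ v_p(m)` on `D`, then `(∏_{p∈D} p^{e p})² ∣ m`. -/
theorem cashout_sq_dvd {m : ℕ} (hm : m ≠ 0) {D : Finset ℕ} (hDP : ∀ r ∈ D, r.Prime) {e : ℕ → ℕ}
    (he2 : ∀ p ∈ D, 2 * e p ≤ m.factorization p) : (∏ r ∈ D, r ^ e r) ^ 2 ∣ m := by
  have hu0 : (∏ r ∈ D, r ^ e r) ≠ 0 := (cashout_prod_pow_pos hDP e).ne'
  rw [← Nat.factorization_le_iff_dvd (pow_ne_zero 2 hu0) hm, Nat.factorization_pow, Finsupp.le_def]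
  intro p
  rw [Finsupp.smul_apply, smul_eq_mul, factorization_prod_prime_pow hDP e p]
  split_ifs with hp
  · exact he2 p hp
  · simp

/-- FULL CAPTURE in the tower sum: if `D ⊆ primeFactors m` and `v_p(m) ≤ n·e p` on `D`, then for
`u = ∏_{p∈D} p^{e p}` and weights `c_i ≥ c_min` (`i < n`),
`c_min · Σ_{p∈D} v_p(m) log p ≤ Σ_{p ∣ m} (Σ_{i<n} c_i · min(v_p(m) − i·v_p(u), v_p(u))) · log p`
(the primes of `m` outside `D` have `v_p(u) = 0` and contribute `0`). -/
theorem cashout_towerG_ge {m n : ℕ} {D : Finset ℕ} (hDsub : D ⊆ m.primeFactors)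
    (hDP : ∀ r ∈ D, r.Prime) {e : ℕ → ℕ} (he1 : ∀ p ∈ D, m.factorization p ≤ n * e p)
    (c : ℕ → ℝ) {cmin : ℝ} (hc : ∀ i : ℕ, i < n → cmin ≤ c i) :
    cmin * ∑ p ∈ D, (m.factorization p : ℝ) * Real.log p ≤
      ∑ p ∈ m.primeFactors, (∑ i ∈ Finset.range n, c i *
        ((min (m.factorization p - i * (∏ r ∈ D, r ^ e r).factorization p)
          ((∏ r ∈ D, r ^ e r).factorization p) : ℕ) : ℝ)) * Real.log p := by
  have hfu := factorization_prod_prime_pow hDP e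
  refine le_trans ?_ (Finset.sum_subset hDsub fun p _ hpD => ?_).le
  · rw [Finset.mul_sum]
    refine Finset.sum_le_sum fun p hp => ?_
    have hlogp : 0 ≤ Real.log p := Real.log_nonneg (by exact_mod_cast (hDP p hp).one_lt.le)
    rw [hfu p, if_pos hp]
    have hcap : ((∑ i ∈ Finset.range n, min (m.factorization p - i * e p) (e p) : ℕ) : ℝ) =
        m.factorization p := by
      rw [cashout_sum_min, min_eq_left (he1 p hp)]
    have hinner : cmin * (m.factorization p : ℝ) ≤
        ∑ i ∈ Finset.range n, c i * ((min (m.factorization p - i * e p) (e p) : ℕ) : ℝ) := by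
      rw [← hcap, Nat.cast_sum, Finset.mul_sum]
      exact Finset.sum_le_sum fun i hi =>
        mul_le_mul_of_nonneg_right (hc i (Finset.mem_range.mp hi)) (Nat.cast_nonneg _)
    calc cmin * ((m.factorization p : ℝ) * Real.log p)
        = cmin * (m.factorization p : ℝ) * Real.log p := by ring
      _ ≤ _ := mul_le_mul_of_nonneg_right hinner hlogp
  · rw [hfu p, if_neg hpD]
    simp

/-- COST of the auxiliary point: if `2n·e p ≤ (n+1)·v_p(m)` on `D`, then
`log ∏_{p∈D} p^{e p} ≤ (n+1)/(2n) · Σ_{p∈D} v_p(m) log p`. -/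
theorem cashout_log_aux_le {m n : ℕ} (hn : 0 < n) {D : Finset ℕ} (hDP : ∀ r ∈ D, r.Prime)
    {e : ℕ → ℕ} (he3 : ∀ p ∈ D, 2 * n * e p ≤ (n + 1) * m.factorization p) :
    Real.log ((∏ r ∈ D, r ^ e r : ℕ) : ℝ) ≤
      ((n : ℝ) + 1) / (2 * n) * ∑ p ∈ D, (m.factorization p : ℝ) * Real.log p := by
  rw [cashout_log_prod_pow hDP, Finset.mul_sum]
  refine Finset.sum_le_sum fun p hp => ?_
  have hlogp : 0 ≤ Real.log p := Real.log_nonneg (by exact_mod_cast (hDP p hp).one_lt.le)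
  have hn' : (0 : ℝ) < 2 * n := by
    have : (0 : ℝ) < n := by exact_mod_cast hn
    linarith
  have h3 : (2 * n * e p : ℝ) ≤ (n + 1) * m.factorization p := by exact_mod_cast he3 p hp
  have hj : (e p : ℝ) ≤ ((n : ℝ) + 1) / (2 * n) * m.factorization p := by
    rw [div_mul_eq_mul_div, le_div_iff₀ hn']
    linarith
  calc (e p : ℝ) * Real.log p ≤ ((n : ℝ) + 1) / (2 * n) * m.factorization p * Real.log p :=
      mul_le_mul_of_nonneg_right hj hlogp
    _ = _ := by ring

/-- If `v_p(m) ≤ n·e p` on `D`, then `Σ_{p∈D} v_p(m) log p ≤ n · log ∏_{p∈D} p^{e p}`. -/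
theorem cashout_sum_le_log_aux {m n : ℕ} {D : Finset ℕ} (hDP : ∀ r ∈ D, r.Prime) {e : ℕ → ℕ}
    (he1 : ∀ p ∈ D, m.factorization p ≤ n * e p) :
    ∑ p ∈ D, (m.factorization p : ℝ) * Real.log p ≤
      n * Real.log ((∏ r ∈ D, r ^ e r : ℕ) : ℝ) := by
  rw [cashout_log_prod_pow hDP, Finset.mul_sum]
  refine Finset.sum_le_sum fun p hp => ?_
  have hlogp : 0 ≤ Real.log p := Real.log_nonneg (by exact_mod_cast (hDP p hp).one_lt.le)
  have h1 : (m.factorization p : ℝ) ≤ n * e p := by exact_mod_cast he1 p hp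
  calc (m.factorization p : ℝ) * Real.log p ≤ (n : ℝ) * e p * Real.log p :=
      mul_le_mul_of_nonneg_right h1 hlogp
    _ = _ := by ring

/-- EXCESS: if `D ⊆ primeFactors m` contains every prime `p ∣ m` with `v_p(m) ≠ 1`, then
`m ≤ rad(m) · exp(Σ_{p∈D} v_p(m) log p)` (`log m − log rad m = Σ_{p ∣ m} (v_p − 1) log p`). -/
theorem cashout_self_le_radical_mul_exp {m : ℕ} (hm : m ≠ 0) {D : Finset ℕ}
    (hDsub : D ⊆ m.primeFactors) (hDc : ∀ p ∈ m.primeFactors, p ∉ D → m.factorization p = 1) :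
    (m : ℝ) ≤ ((radical m : ℕ) : ℝ) * Real.exp (∑ p ∈ D, (m.factorization p : ℝ) * Real.log p) := by
  have hlogm : Real.log m = ∑ p ∈ m.primeFactors, (m.factorization p : ℝ) * Real.log p := by
    rw [Real.log_nat_eq_sum_factorization, Finsupp.sum, Nat.support_factorization]
  have hlogr : Real.log ((radical m : ℕ) : ℝ) = ∑ p ∈ m.primeFactors, Real.log p := by
    rw [Nat.radical_eq_prod_primeFactors, Nat.cast_prod, Real.log_prod]
    exact fun p hp => by exact_mod_cast (Nat.prime_of_mem_primeFactors hp).ne_zero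
  have h1 : ∑ p ∈ m.primeFactors, (m.factorization p : ℝ) * Real.log p =
      ∑ p ∈ m.primeFactors, Real.log p +
        ∑ p ∈ m.primeFactors, ((m.factorization p : ℝ) - 1) * Real.log p := by
    rw [← Finset.sum_add_distrib]
    exact Finset.sum_congr rfl fun p _ => by ring
  have h2 : ∑ p ∈ m.primeFactors, ((m.factorization p : ℝ) - 1) * Real.log p =
      ∑ p ∈ D, ((m.factorization p : ℝ) - 1) * Real.log p :=
    (Finset.sum_subset hDsub fun p hp hpD => by rw [hDc p hp hpD]; simp).symm
  have h3 : ∑ p ∈ D, ((m.factorization p : ℝ) - 1) * Real.log p ≤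
      ∑ p ∈ D, (m.factorization p : ℝ) * Real.log p :=
    Finset.sum_le_sum fun p hp => by
      have hlogp : 0 ≤ Real.log p :=
        Real.log_nonneg (by exact_mod_cast (Nat.prime_of_mem_primeFactors (hDsub hp)).one_lt.le)
      linarith
  have hle : Real.log m ≤
      Real.log ((radical m : ℕ) : ℝ) + ∑ p ∈ D, (m.factorization p : ℝ) * Real.log p := by
    rw [hlogm, hlogr]
    linarith
  have hm0 : (0 : ℝ) < m := by exact_mod_cast Nat.pos_of_ne_zero hm
  have hr0 : (0 : ℝ) < ((radical m : ℕ) : ℝ) := by exact_mod_cast Nat.radical_pos m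
  calc (m : ℝ) = Real.exp (Real.log m) := (Real.exp_log hm0).symm
    _ ≤ Real.exp (Real.log ((radical m : ℕ) : ℝ) +
          ∑ p ∈ D, (m.factorization p : ℝ) * Real.log p) := Real.exp_le_exp.mpr hle
    _ = ((radical m : ℕ) : ℝ) * Real.exp (∑ p ∈ D, (m.factorization p : ℝ) * Real.log p) := by
        rw [Real.exp_add, Real.exp_log hr0]

/-- **The adaptive auxiliary point, packaged.** For `n ≥ 3`, `m ≠ 0` and weights `c_i ≥ c_min`
(`i < n`) there are `u` with `u² ∣ m` (namely `u = ∏_{v_p(m) ≥ 2} p^{⌈v_p(m)/n⌉}`) and a real `V`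
(namely `Σ_{v_p(m) ≥ 2} v_p(m) log p`) with: `c_min·V ≤ G_n(c; m, u)` (full capture),
`log u ≤ (n+1)/(2n)·V` (cost), `V ≤ n·log u`, and `m ≤ rad(m)·e^V` (excess). -/
theorem cashout_aux {n : ℕ} (hn : 3 ≤ n) {m : ℕ} (hm : m ≠ 0) (c : ℕ → ℝ) (cmin : ℝ)
    (hc : ∀ i : ℕ, i < n → cmin ≤ c i) :
    ∃ u : ℕ, 0 < u ∧ u ^ 2 ∣ m ∧ ∃ V : ℝ,
      cmin * V ≤ ∑ p ∈ m.primeFactors, (∑ i ∈ Finset.range n, c i *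
          ((min (m.factorization p - i * u.factorization p) (u.factorization p) : ℕ) : ℝ))
        * Real.log p ∧
      Real.log u ≤ ((n : ℝ) + 1) / (2 * n) * V ∧
      V ≤ n * Real.log u ∧
      (m : ℝ) ≤ ((radical m : ℕ) : ℝ) * Real.exp V := by
  obtain ⟨D, hD⟩ : ∃ D : Finset ℕ, D = m.primeFactors.filter (fun p => 2 ≤ m.factorization p) :=
    ⟨_, rfl⟩
  have hDsub : D ⊆ m.primeFactors := hD ▸ Finset.filter_subset _ _
  have hDP : ∀ p ∈ D, p.Prime := fun p hp => Nat.prime_of_mem_primeFactors (hDsub hp)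
  have hDv : ∀ p ∈ D, 2 ≤ m.factorization p := fun p hp => by
    rw [hD] at hp
    exact (Finset.mem_filter.mp hp).2
  have hDc : ∀ p ∈ m.primeFactors, p ∉ D → m.factorization p = 1 := by
    intro p hp hpD
    have h1 : m.factorization p ≠ 0 :=
      Finsupp.mem_support_iff.mp (by rwa [Nat.support_factorization])
    have h2 : ¬ 2 ≤ m.factorization p := fun h => hpD (hD ▸ Finset.mem_filter.mpr ⟨hp, h⟩)
    omega
  have hn0 : 0 < n := by omega
  have he1 : ∀ p ∈ D, m.factorization p ≤ n * ((m.factorization p - 1) / n + 1) :=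
    fun p _ => cashout_le_mul_ceil _ hn0
  have he2 : ∀ p ∈ D, 2 * ((m.factorization p - 1) / n + 1) ≤ m.factorization p :=
    fun p hp => cashout_two_mul_ceil_le hn (hDv p hp)
  have he3 : ∀ p ∈ D, 2 * n * ((m.factorization p - 1) / n + 1) ≤ (n + 1) * m.factorization p :=
    fun p hp => cashout_cost_le (by omega) (hDv p hp)
  exact ⟨∏ r ∈ D, r ^ ((m.factorization r - 1) / n + 1), cashout_prod_pow_pos hDP _,
    cashout_sq_dvd hm hDP he2, ∑ p ∈ D, (m.factorization p : ℝ) * Real.log p,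
    cashout_towerG_ge hDsub hDP he1 c hc, cashout_log_aux_le hn0 hDP he3,
    cashout_sum_le_log_aux hDP he1, cashout_self_le_radical_mul_exp hm hDsub hDc⟩

/-! ## The cash-out -/

/-- **stub_cashout (the adaptive-design cash-out of the line `nevbir-below-beta`).** If a level-`n ≥ 3`
weighted inequality holds at the family points `(q^k, u)`, `u ∣ q^k − 1`, off the curve `F = 0`, with
`c_i ≥ c_min`, `b_Y, ε ≥ 0`, `κ = (1+ε)c_min − b_Y(n+1)/(2n) > 0`, `θ₀ = 1+ε−2b_H−b_Y ≥ 0`, and the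
family points on `F = 0` with `u² ∣ q^k − 1` have bounded `u`, then
`q^k − 1 ≤ C·q^{(θ₀/κ)k}·rad(q^k − 1)` for all `k ≥ 1`. This is the registered stub with the
skeleton's `TowerIneq`, `towerG`, `OnCurveBounded` unfolded; proof: `cashout_aux` at `m = q^k − 1`
and the real-analysis glue described in the module docstring. -/
theorem stub_cashout {q n : ℕ} (hq : 2 ≤ q) (hn : 3 ≤ n) {c : ℕ → ℝ} {cmin bH bY ε : ℝ}
    {F : MvPolynomial (Fin 2) ℤ}
    (hc : ∀ i : ℕ, i < n → cmin ≤ c i) (hbY : 0 ≤ bY) (hε : 0 ≤ ε)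
    (hκ : 0 < (1 + ε) * cmin - bY * (((n : ℝ) + 1) / (2 * n)))
    (hθ : 0 ≤ 1 + ε - 2 * bH - bY)
    (hineq : ∃ C : ℝ, ∀ k : ℕ, 1 ≤ k → ∀ u : ℕ, u ∣ q ^ k - 1 →
      MvPolynomial.eval ![((q : ℤ) ^ k), (u : ℤ)] F ≠ 0 →
        bH * (2 * ((k : ℝ) * Real.log q)) + bY * ((k : ℝ) * Real.log q - Real.log u)
          ≤ (1 + ε) * ((k : ℝ) * Real.log q -
              ∑ p ∈ (q ^ k - 1).primeFactors,
                (∑ i ∈ Finset.range n, c i *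
                  ((min ((q ^ k - 1).factorization p - i * u.factorization p) (u.factorization p) : ℕ) : ℝ))
                * Real.log p) + C)
    (hexc : ∃ C : ℝ, ∀ k : ℕ, 1 ≤ k → ∀ u : ℕ, u ^ 2 ∣ q ^ k - 1 →
      MvPolynomial.eval ![((q : ℤ) ^ k), (u : ℤ)] F = 0 → (u : ℝ) ≤ C) :
    ∃ C : ℝ, ∀ k : ℕ, 1 ≤ k →
      ((q ^ k - 1 : ℕ) : ℝ) ≤
        C * (q : ℝ) ^ ((1 + ε - 2 * bH - bY) / ((1 + ε) * cmin - bY * (((n : ℝ) + 1) / (2 * n))) * k)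
          * ((radical (q ^ k - 1) : ℕ) : ℝ) := by
  obtain ⟨C₁, hineq⟩ := hineq
  obtain ⟨C₂, hexc⟩ := hexc
  set θ₀ : ℝ := 1 + ε - 2 * bH - bY with hθ₀
  set κ : ℝ := (1 + ε) * cmin - bY * (((n : ℝ) + 1) / (2 * n)) with hκ'
  have hq0 : (0 : ℝ) < q := by exact_mod_cast (show 0 < q by omega)
  have hq1 : (1 : ℝ) ≤ q := by exact_mod_cast (show 1 ≤ q by omega)
  have hn0 : (0 : ℝ) < n := by exact_mod_cast (show 0 < n by omega)
  have hρ : 0 ≤ θ₀ / κ := div_nonneg hθ hκ.le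
  refine ⟨max (Real.exp (C₁ / κ)) (Real.exp (n * Real.log (max 1 C₂))), fun k hk => ?_⟩
  have hm0 : q ^ k - 1 ≠ 0 := by have := two_le_pow hq hk; omega
  obtain ⟨u, hu0, hu2, V, hG, hLu, hVu, hmV⟩ := cashout_aux hn hm0 c cmin hc
  have hQ1 : (1 : ℝ) ≤ (q : ℝ) ^ (θ₀ / κ * k) :=
    Real.one_le_rpow hq1 (mul_nonneg hρ (Nat.cast_nonneg k))
  have hR0 : (0 : ℝ) ≤ ((radical (q ^ k - 1) : ℕ) : ℝ) := Nat.cast_nonneg _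
  have hM0 : 0 ≤ max (Real.exp (C₁ / κ)) (Real.exp (n * Real.log (max 1 C₂))) :=
    le_max_of_le_left (Real.exp_nonneg _)
  by_cases hz : MvPolynomial.eval ![((q : ℤ) ^ k), (u : ℤ)] F = 0
  · -- ON the exceptional curve: `u ≤ C₂`, so `V ≤ n log u` is bounded
    have hu0' : (0 : ℝ) < u := by exact_mod_cast hu0
    have hlogu : Real.log u ≤ Real.log (max 1 C₂) :=
      Real.log_le_log hu0' ((hexc k hk u hu2 hz).trans (le_max_right _ _))
    have hV : V ≤ n * Real.log (max 1 C₂) := hVu.trans (mul_le_mul_of_nonneg_left hlogu hn0.le)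
    calc ((q ^ k - 1 : ℕ) : ℝ) ≤ ((radical (q ^ k - 1) : ℕ) : ℝ) * Real.exp V := hmV
      _ ≤ ((radical (q ^ k - 1) : ℕ) : ℝ) *
            (max (Real.exp (C₁ / κ)) (Real.exp (n * Real.log (max 1 C₂))) *
              (q : ℝ) ^ (θ₀ / κ * k)) := by
          refine mul_le_mul_of_nonneg_left ?_ hR0
          calc Real.exp V ≤ Real.exp (n * Real.log (max 1 C₂)) := Real.exp_le_exp.mpr hV
            _ ≤ max (Real.exp (C₁ / κ)) (Real.exp (n * Real.log (max 1 C₂))) := le_max_right _ _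
            _ ≤ _ := le_mul_of_one_le_right hM0 hQ1
      _ = max (Real.exp (C₁ / κ)) (Real.exp (n * Real.log (max 1 C₂))) *
            (q : ℝ) ^ (θ₀ / κ * k) * ((radical (q ^ k - 1) : ℕ) : ℝ) := by ring
  · -- OFF the curve: the inequality at the adaptive auxiliary point
    have hdvd : u ∣ q ^ k - 1 := (dvd_pow_self u two_ne_zero).trans hu2
    have hI := hineq k hk u hdvd hz
    have h1 := mul_le_mul_of_nonneg_left hG (show (0 : ℝ) ≤ 1 + ε by linarith)
    have h2 := mul_le_mul_of_nonneg_left hLu hbY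
    have hκV : κ * V ≤ θ₀ * ((k : ℝ) * Real.log q) + C₁ := by
      rw [hκ', hθ₀]
      linarith
    have hV : V ≤ θ₀ / κ * ((k : ℝ) * Real.log q) + C₁ / κ := by
      rw [div_mul_eq_mul_div, ← add_div, le_div_iff₀ hκ]
      linarith
    calc ((q ^ k - 1 : ℕ) : ℝ) ≤ ((radical (q ^ k - 1) : ℕ) : ℝ) * Real.exp V := hmV
      _ ≤ ((radical (q ^ k - 1) : ℕ) : ℝ) *
            Real.exp (θ₀ / κ * ((k : ℝ) * Real.log q) + C₁ / κ) :=
          mul_le_mul_of_nonneg_left (Real.exp_le_exp.mpr hV) hR0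
      _ = Real.exp (C₁ / κ) * (q : ℝ) ^ (θ₀ / κ * k) * ((radical (q ^ k - 1) : ℕ) : ℝ) := by
          rw [Real.exp_add, Real.rpow_def_of_pos hq0,
            show Real.log q * (θ₀ / κ * k) = θ₀ / κ * ((k : ℝ) * Real.log q) by ring]
          ring
      _ ≤ max (Real.exp (C₁ / κ)) (Real.exp (n * Real.log (max 1 C₂))) *
            (q : ℝ) ^ (θ₀ / κ * k) * ((radical (q ^ k - 1) : ℕ) : ℝ) := by
          gcongr
          exact le_max_left _ _

end Summit.ABC.ABC.Theorems.PrimePowerRadical.NevbirBelowBeta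

end
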